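import Summits.MatrixMultiplication.MatrixMultiplication.Theses.CubicExchangeSplit

/-!
# Load-bearing analysis of the crux `CubicExchangeSplit.CubicAmortisation` (E₃)

Crux `CubicExchangeSplit.CubicAmortisation` (stmt-MatrixMultiplication-18000), refuter lane
(`Theorems/CubicAmortisation/Negative/`; crux-attack at birth, 2026-08-17).  The crux reads, verbatim
(`crux_iff`): for every `ε > 0`, `R(⟨n,n,n³⟩) = O(n^{4+ε})` (`R = tensorRank ∘ matMulTensor ℂ`), i.e.
`ω(1,1,3) = 4`.  Recorded here, sorry-free:

* `not_isBigO_rank_cubic_of_lt_four` — TIGHTNESS: no exponent `β < 4` is admissible for `⟨n,n,n³⟩`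
  (flattening `n·n³ ≤ R(⟨n,n,n³⟩)`, tree `mul_le_tensorRank_matMulTensor_right`); the `4` in the crux is
  the flattening floor and cannot be lowered, so the crux is the strongest statement of its shape.
* `cubicAmortisation_false_at_neg`, `cubicAmortisation_false_without_pos` — the hypothesis `0 < ε` is
  LOAD-BEARING: dropping it (any `ε < 0`, witness `ε = -1`) makes the bound false.
* `isBigO_rank_cubic_of_one_le` — the TRIVIAL REGIME: for `ε ≥ 1` the bound is the standard algorithm
  (`R(⟨n,n,n³⟩) ≤ n⁵`, tree `tensorRank_matMulTensor_le`), so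
* `cubicAmortisation_iff_unit_interval` — the whole content of the crux is the window `0 < ε < 1`
  (`n^{4+o(1)}` versus the known sandwich `n⁴ ≤ R(⟨n,n,n³⟩) ≤ n⁵`).

No theorem here asserts a Theses decl positively (the `iff` is a reformulation, both sides open).
-/

-- single-conjunct summit: the mandated namespace `Summit.MatrixMultiplication.MatrixMultiplication.…`
-- repeats a component, which the dupNamespace linter would flag on every declaration.
set_option linter.dupNamespace false

namespace Summit.MatrixMultiplication.MatrixMultiplication.Theorems.CubicAmortisation.Negative

open Filter Asymptotics
open Literature.Computability.AlgebraicComplexity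
open Summit.MatrixMultiplication.MatrixMultiplication.Theses.CubicExchangeSplit

/-- Read-back: the crux unfolds, by `Iff.rfl`, to the verbatim body below. -/
theorem crux_iff : CubicAmortisation ↔
    ∀ ε : ℝ, 0 < ε → (fun n : ℕ => (tensorRank (matMulTensor ℂ n n (n ^ 3)) : ℝ)) =O[atTop]
      fun n : ℕ => (n : ℝ) ^ ((4 : ℝ) + ε) := Iff.rfl

/-- TIGHTNESS at the flattening floor: for every real `β < 4`, `R(⟨n,n,n³⟩)` is NOT `O(n^β)`,
because `n⁴ = n·n³ ≤ R(⟨n,n,n³⟩)` (flattening along the third factor) and `n^{4-β} → ∞`. -/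
theorem not_isBigO_rank_cubic_of_lt_four {β : ℝ} (hβ : β < 4) :
    ¬ ((fun n : ℕ => (tensorRank (matMulTensor ℂ n n (n ^ 3)) : ℝ)) =O[atTop]
        (fun n : ℕ => (n : ℝ) ^ β)) := by
  intro hO
  obtain ⟨C, hC⟩ := isBigO_iff.1 hO
  have hev : ∀ᶠ n : ℕ in atTop, (n : ℝ) ^ ((4 : ℝ) - β) ≤ C := by
    filter_upwards [hC, eventually_gt_atTop 0] with n hn hn0
    have hn0' : (0 : ℝ) < n := Nat.cast_pos.2 hn0
    rw [Real.norm_of_nonneg (Nat.cast_nonneg _),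
      Real.norm_of_nonneg (Real.rpow_nonneg (Nat.cast_nonneg _) _)] at hn
    have hflat : n * n ^ 3 ≤ tensorRank (matMulTensor ℂ n n (n ^ 3)) := by
      haveI : NeZero n := ⟨hn0.ne'⟩
      exact mul_le_tensorRank_matMulTensor_right ℂ n n (n ^ 3)
    have hpow : (n : ℝ) ^ (4 : ℝ) = ((n * n ^ 3 : ℕ) : ℝ) := by
      rw [show (4 : ℝ) = ((4 : ℕ) : ℝ) by norm_num, Real.rpow_natCast]
      push_cast
      ring
    have h4 : (n : ℝ) ^ (4 : ℝ) ≤ C * (n : ℝ) ^ β := by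
      refine le_trans ?_ hn
      rw [hpow]
      exact_mod_cast hflat
    rw [Real.rpow_sub hn0', div_le_iff₀ (Real.rpow_pos_of_pos hn0' _)]
    exact h4
  have hlim : Tendsto (fun n : ℕ => (n : ℝ) ^ ((4 : ℝ) - β)) atTop atTop :=
    (tendsto_rpow_atTop (by linarith)).comp tendsto_natCast_atTop_atTop
  obtain ⟨n, hn₁, hn₂⟩ := (hev.and (hlim.eventually_gt_atTop C)).exists
  exact absurd hn₁ (not_le.2 hn₂)

/-- The crux's bound fails at every negative slack `ε < 0` (exponent `4 + ε < 4`). -/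
theorem cubicAmortisation_false_at_neg {ε : ℝ} (hε : ε < 0) :
    ¬ ((fun n : ℕ => (tensorRank (matMulTensor ℂ n n (n ^ 3)) : ℝ)) =O[atTop]
        (fun n : ℕ => (n : ℝ) ^ ((4 : ℝ) + ε))) :=
  not_isBigO_rank_cubic_of_lt_four (by linarith)

/-- LOAD-BEARING hypothesis `0 < ε`: the crux with the positivity hypothesis dropped is false
(witness `ε = -1`: `R(⟨n,n,n³⟩) ≥ n⁴` is not `O(n³)`).  Any proof of the crux must use `0 < ε`. -/
theorem cubicAmortisation_false_without_pos :
    ¬ (∀ ε : ℝ, (fun n : ℕ => (tensorRank (matMulTensor ℂ n n (n ^ 3)) : ℝ)) =O[atTop]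
        fun n : ℕ => (n : ℝ) ^ ((4 : ℝ) + ε)) :=
  fun h => cubicAmortisation_false_at_neg (by norm_num : (-1 : ℝ) < 0) (h (-1))

/-- TRIVIAL REGIME: for `ε ≥ 1` the crux's bound is the standard algorithm,
`R(⟨n,n,n³⟩) ≤ n·n·n³ = n⁵ ≤ n^{4+ε}` (`n ≥ 1`). -/
theorem isBigO_rank_cubic_of_one_le {ε : ℝ} (hε : 1 ≤ ε) :
    (fun n : ℕ => (tensorRank (matMulTensor ℂ n n (n ^ 3)) : ℝ)) =O[atTop]
      (fun n : ℕ => (n : ℝ) ^ ((4 : ℝ) + ε)) := by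
  refine IsBigO.of_bound 1 ?_
  filter_upwards [eventually_ge_atTop 1] with n hn
  have hn' : (1 : ℝ) ≤ n := by exact_mod_cast hn
  rw [one_mul, Real.norm_of_nonneg (Nat.cast_nonneg _),
    Real.norm_of_nonneg (Real.rpow_nonneg (Nat.cast_nonneg _) _)]
  have h := tensorRank_matMulTensor_le ℂ n n (n ^ 3)
  calc (tensorRank (matMulTensor ℂ n n (n ^ 3)) : ℝ) ≤ ((n * n * n ^ 3 : ℕ) : ℝ) := by
        exact_mod_cast h
    _ = (n : ℝ) ^ (5 : ℝ) := by
      rw [show (5 : ℝ) = ((5 : ℕ) : ℝ) by norm_num, Real.rpow_natCast]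
      push_cast
      ring
    _ ≤ (n : ℝ) ^ ((4 : ℝ) + ε) := Real.rpow_le_rpow_of_exponent_le hn' (by linarith)

/-- The content of the crux is exactly the window `0 < ε < 1`: `CubicAmortisation` is equivalent to
its restriction to `ε ∈ (0,1)` (the rest is the standard algorithm). -/
theorem cubicAmortisation_iff_unit_interval :
    CubicAmortisation ↔ ∀ ε : ℝ, 0 < ε → ε < 1 →
      (fun n : ℕ => (tensorRank (matMulTensor ℂ n n (n ^ 3)) : ℝ)) =O[atTop]
        (fun n : ℕ => (n : ℝ) ^ ((4 : ℝ) + ε)) := by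
  refine ⟨fun h ε hε _ => h ε hε, fun h ε hε => ?_⟩
  rcases le_or_gt 1 ε with hle | hlt
  · exact isBigO_rank_cubic_of_one_le hle
  · exact h ε hε hlt

end Summit.MatrixMultiplication.MatrixMultiplication.Theorems.CubicAmortisation.Negative
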